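import Summits.KontsevichZagierPeriods.KontsevichZagierPeriods.Theorems.LinRedNormalFormArrangementNormalFormSeparateTwoNormEquiv

/-!
# The one-dimensional brick of the fibre-free termwise split in dimension three

(Line `janus-bands`, crux `ArrangementNormalForm`, stub `stub_separateThreeZero`, part `HIBrick` of
the termwise numerator split `separateThree_hI` under the rim condition.)

On a THICK vertical fibre `(lo, hi)`, `0 ≤ lo ≤ θ hi` (`θ < 1` fixed), every term of a polynomial
`∑_{j<N} Q_j w^j` is dominated against the pole weight `w^{-n}`:
`∫_{lo}^{hi} |Q_i| w^{i-n} dw ≤ C(N, n, θ) ∫_{lo}^{hi} |∑_j Q_j w^j| w^{-n} dw` (`brick`, registered as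
`separateThree_brick`; stated with lower Lebesgue integrals so that `lo = 0` is allowed). Proof:
geometric blocks `(θ^{k+1} hi, θ^k hi]`; on a block the weight is constant up to `θ^{-n}` and the
coefficients are controlled by the `L¹`-norm (`SepTwo.exists_coeff_le_lone`, rescaled:
`exists_coeff_scale_le`); the one incomplete block at the bottom is compared with the complete block
above it, which exists by thickness.
-/

noncomputable section

open Set MeasureTheory intervalIntegral
open scoped ENNReal

namespace Summit.KontsevichZagierPeriods.ArrangementNormalForm.JanusBands

namespace SepThree

/-! ### Polynomials in range form and norm equivalence -/

/-- The polynomial `w ↦ ∑_{j<N} Q j w^j`. -/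
def psum (N : ℕ) (Q : ℕ → ℝ) (w : ℝ) : ℝ := ∑ j ∈ Finset.range N, Q j * w ^ j

/-- `psum` is continuous. -/
theorem continuous_psum (N : ℕ) (Q : ℕ → ℝ) : Continuous (psum N Q) := by
  unfold psum; fun_prop

/-- Dilating the variable rescales the coefficients. -/
theorem psum_scale (N : ℕ) (Q : ℕ → ℝ) (ρ t : ℝ) :
    psum N Q (ρ * t) = psum N (fun j => Q j * ρ ^ j) t := by
  unfold psum
  refine Finset.sum_congr rfl fun j _ => ?_
  rw [mul_pow]; ring

/-- `psum (d+1)` is `SepTwo.pev` of the truncated coefficient vector. -/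
theorem psum_eq_pev (d : ℕ) (Q : ℕ → ℝ) (t : ℝ) :
    psum (d + 1) Q t = SepTwo.pev (fun j : Fin (d + 1) => Q j) t := by
  unfold psum SepTwo.pev
  rw [Finset.sum_range]

/-- **Norm equivalence in range form**: every coefficient is bounded by the `L¹`-norm on `[a, b]`. -/
theorem exists_coeff_le_integral (N : ℕ) {a b : ℝ} (hab : a < b) :
    ∃ C : ℝ, 0 < C ∧ ∀ (Q : ℕ → ℝ), ∀ i < N, |Q i| ≤ C * ∫ t in a..b, |psum N Q t| := by
  cases N with
  | zero => exact ⟨1, one_pos, fun Q i hi => absurd hi (Nat.not_lt_zero _)⟩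
  | succ d =>
    obtain ⟨C, hC, h⟩ := SepTwo.exists_coeff_le_lone d hab
    refine ⟨C, hC, fun Q i hi => ?_⟩
    have h1 := h (fun j : Fin (d + 1) => Q j) ⟨i, hi⟩
    simp only [SepTwo.lone, ← psum_eq_pev] at h1
    exact h1

/-- **Rescaled norm equivalence**: `|Q i| ρ^i · ρ ≤ C ∫_{ρa}^{ρb} |∑ Q_j w^j| dw` for `ρ > 0`. -/
theorem exists_coeff_scale_le (N : ℕ) {a b : ℝ} (hab : a < b) :
    ∃ C : ℝ, 0 < C ∧ ∀ (Q : ℕ → ℝ) (ρ : ℝ), 0 < ρ → ∀ i < N,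
      |Q i| * ρ ^ i * ρ ≤ C * ∫ w in ρ * a..ρ * b, |psum N Q w| := by
  obtain ⟨C, hC, h⟩ := exists_coeff_le_integral N hab
  refine ⟨C, hC, fun Q ρ hρ i hi => ?_⟩
  have h1 := h (fun j => Q j * ρ ^ j) i hi
  have h2 : ∫ t in a..b, |psum N (fun j => Q j * ρ ^ j) t| =
      ρ⁻¹ * ∫ w in ρ * a..ρ * b, |psum N Q w| := by
    simp_rw [← psum_scale]
    rw [intervalIntegral.integral_comp_mul_left (fun w => |psum N Q w|) hρ.ne', smul_eq_mul]
  rw [h2, abs_mul, abs_of_nonneg (pow_nonneg hρ.le _)] at h1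
  calc |Q i| * ρ ^ i * ρ ≤ C * (ρ⁻¹ * ∫ w in ρ * a..ρ * b, |psum N Q w|) * ρ :=
        mul_le_mul_of_nonneg_right h1 hρ.le
    _ = C * ∫ w in ρ * a..ρ * b, |psum N Q w| := by field_simp

/-! ### Blocks -/

/-- The right-hand integrand `|∑ Q_j w^j| · |w|^{-n}` is measurable. -/
theorem measurable_rhs (N n : ℕ) (Q : ℕ → ℝ) :
    Measurable fun w : ℝ => ‖psum N Q w * (1 / w) ^ n‖ₑ :=
  ((continuous_psum N Q).measurable.mul ((measurable_const.div measurable_id).pow_const n)).enorm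

/-- On the block `(θ b, b]` the weighted monomial `w^i/w^n` is at most `b^i/(θ^n b^n)`. -/
theorem mono_le_on_block {θ b : ℝ} (hθ : 0 < θ) (hb : 0 < b) (i n : ℕ) {w : ℝ}
    (hw : w ∈ Ioc (θ * b) b) : w ^ i / w ^ n ≤ b ^ i / (θ ^ n * b ^ n) := by
  have hw0 : 0 < w := (mul_pos hθ hb).trans hw.1
  rw [div_le_div_iff₀ (pow_pos hw0 n) (by positivity)]
  have h1 : w ^ i ≤ b ^ i := pow_le_pow_left₀ hw0.le hw.2 i
  have h2 : θ ^ n * b ^ n ≤ w ^ n := by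
    rw [← mul_pow]; exact pow_le_pow_left₀ (by positivity) hw.1.le n
  exact mul_le_mul h1 h2 (by positivity) (by positivity)

/-- The block integral of a weighted term. -/
theorem lintegral_block_le {θ b : ℝ} (hθ : 0 < θ) (hb : 0 < b) (Q : ℕ → ℝ) (i n : ℕ) :
    ∫⁻ w in Ioc (θ * b) b, ‖Q i * (w ^ i / w ^ n)‖ₑ ≤
      ENNReal.ofReal (|Q i| * b ^ i * b / (θ ^ n * b ^ n)) := by
  have hθb : 0 < θ * b := mul_pos hθ hb
  calc ∫⁻ w in Ioc (θ * b) b, ‖Q i * (w ^ i / w ^ n)‖ₑ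
      ≤ ∫⁻ _ in Ioc (θ * b) b, ENNReal.ofReal (|Q i| * (b ^ i / (θ ^ n * b ^ n))) := by
        refine setLIntegral_mono measurable_const fun w hw => ?_
        have hw0 : 0 < w := hθb.trans hw.1
        rw [Real.enorm_eq_ofReal_abs, abs_mul,
          abs_of_nonneg (div_nonneg (pow_nonneg hw0.le _) (pow_nonneg hw0.le _))]
        exact ENNReal.ofReal_le_ofReal
          (mul_le_mul_of_nonneg_left (mono_le_on_block hθ hb i n hw) (abs_nonneg _))
    _ = ENNReal.ofReal (|Q i| * (b ^ i / (θ ^ n * b ^ n))) * volume (Ioc (θ * b) b) :=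
        setLIntegral_const _ _
    _ ≤ ENNReal.ofReal (|Q i| * (b ^ i / (θ ^ n * b ^ n))) * ENNReal.ofReal b := by
        rw [Real.volume_Ioc]
        gcongr
        linarith
    _ = ENNReal.ofReal (|Q i| * b ^ i * b / (θ ^ n * b ^ n)) := by
        rw [← ENNReal.ofReal_mul (by positivity)]
        congr 1
        field_simp

/-- **Coefficients against the block integral**: `|Q i| b^i · b / b^n ≤ C ∫_{(θb, b]} |∑ Q_j w^j| w^{-n}`. -/
theorem coeff_block_le (N n : ℕ) {θ : ℝ} (hθ : 0 < θ) (hθ1 : θ < 1) :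
    ∃ C : ℝ, 0 < C ∧ ∀ (Q : ℕ → ℝ) (b : ℝ), 0 < b → ∀ i < N,
      ENNReal.ofReal (|Q i| * b ^ i * b / b ^ n) ≤
        ENNReal.ofReal C * ∫⁻ w in Ioc (θ * b) b, ‖psum N Q w * (1 / w) ^ n‖ₑ := by
  obtain ⟨C, hC, h⟩ := exists_coeff_scale_le N hθ1
  refine ⟨C, hC, fun Q b hb i hi => ?_⟩
  have h1 := h Q b hb i hi
  rw [mul_one] at h1
  have hle : b * θ ≤ b := by nlinarith
  have hint : IntegrableOn (fun w => |psum N Q w|) (Ioc (b * θ) b) :=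
    ((continuous_psum N Q).abs.integrableOn_Icc (a := b * θ) (b := b)).mono_set Ioc_subset_Icc_self
  have h2 : ENNReal.ofReal (∫ w in b * θ..b, |psum N Q w|) =
      ∫⁻ w in Ioc (θ * b) b, ‖psum N Q w‖ₑ := by
    rw [intervalIntegral.integral_of_le hle,
      ofReal_integral_eq_lintegral_ofReal hint (ae_of_all _ fun _ => abs_nonneg _), mul_comm b θ]
    simp_rw [← Real.enorm_eq_ofReal_abs]
  have hbn : 0 < b ^ n := pow_pos hb n
  calc ENNReal.ofReal (|Q i| * b ^ i * b / b ^ n)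
      = ENNReal.ofReal (|Q i| * b ^ i * b) * ENNReal.ofReal (1 / b ^ n) := by
        rw [← ENNReal.ofReal_mul (by positivity), mul_one_div]
    _ ≤ ENNReal.ofReal (C * ∫ w in b * θ..b, |psum N Q w|) * ENNReal.ofReal (1 / b ^ n) := by
        gcongr
    _ = ENNReal.ofReal C * ((∫⁻ w in Ioc (θ * b) b, ‖psum N Q w‖ₑ) * ENNReal.ofReal (1 / b ^ n)) := by
        rw [ENNReal.ofReal_mul hC.le, h2, mul_assoc]
    _ = ENNReal.ofReal C * ∫⁻ w in Ioc (θ * b) b, ‖psum N Q w‖ₑ * ENNReal.ofReal (1 / b ^ n) := by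
        rw [lintegral_mul_const _ (continuous_psum N Q).measurable.enorm]
    _ ≤ ENNReal.ofReal C * ∫⁻ w in Ioc (θ * b) b, ‖psum N Q w * (1 / w) ^ n‖ₑ := by
        gcongr ENNReal.ofReal C * ?_
        refine setLIntegral_mono (measurable_rhs N n Q) fun w hw => ?_
        have hw0 : 0 < w := (mul_pos hθ hb).trans hw.1
        rw [enorm_mul, Real.enorm_eq_ofReal_abs ((1 / w) ^ n)]
        gcongr
        rw [abs_of_nonneg (by positivity), one_div_pow]
        exact one_div_le_one_div_of_le (pow_pos hw0 n) (pow_le_pow_left₀ hw0.le hw.2 n)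

/-- **A complete block.** -/
theorem block_le (N n : ℕ) {θ : ℝ} (hθ : 0 < θ) (hθ1 : θ < 1) :
    ∃ C : ℝ, 0 < C ∧ ∀ (Q : ℕ → ℝ) (b : ℝ), 0 < b → ∀ i < N,
      ∫⁻ w in Ioc (θ * b) b, ‖Q i * (w ^ i / w ^ n)‖ₑ ≤
        ENNReal.ofReal (C / θ ^ n) * ∫⁻ w in Ioc (θ * b) b, ‖psum N Q w * (1 / w) ^ n‖ₑ := by
  obtain ⟨C, hC, h⟩ := coeff_block_le N n hθ hθ1
  refine ⟨C, hC, fun Q b hb i hi => (lintegral_block_le hθ hb Q i n).trans ?_⟩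
  have hθn : 0 < θ ^ n := pow_pos hθ n
  calc ENNReal.ofReal (|Q i| * b ^ i * b / (θ ^ n * b ^ n))
      = ENNReal.ofReal (1 / θ ^ n) * ENNReal.ofReal (|Q i| * b ^ i * b / b ^ n) := by
        rw [← ENNReal.ofReal_mul (by positivity)]
        congr 1
        field_simp
    _ ≤ ENNReal.ofReal (1 / θ ^ n) * (ENNReal.ofReal C *
          ∫⁻ w in Ioc (θ * b) b, ‖psum N Q w * (1 / w) ^ n‖ₑ) := by
        gcongr
        exact h Q b hb i hi
    _ = ENNReal.ofReal (C / θ ^ n) * ∫⁻ w in Ioc (θ * b) b, ‖psum N Q w * (1 / w) ^ n‖ₑ := by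
        rw [← mul_assoc, ← ENNReal.ofReal_mul (by positivity)]
        congr 2
        field_simp

/-- **The incomplete block** `(θ² b, θ b]` against the complete block `(θ b, b]` above it. -/
theorem partial_le (N n : ℕ) {θ : ℝ} (hθ : 0 < θ) (hθ1 : θ < 1) :
    ∃ C : ℝ, 0 < C ∧ ∀ (Q : ℕ → ℝ) (b : ℝ), 0 < b → ∀ i < N,
      ∫⁻ w in Ioc (θ * (θ * b)) (θ * b), ‖Q i * (w ^ i / w ^ n)‖ₑ ≤
        ENNReal.ofReal (C / θ ^ (2 * n)) * ∫⁻ w in Ioc (θ * b) b, ‖psum N Q w * (1 / w) ^ n‖ₑ := by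
  obtain ⟨C, hC, h⟩ := coeff_block_le N n hθ hθ1
  refine ⟨C, hC, fun Q b hb i hi => (lintegral_block_le hθ (mul_pos hθ hb) Q i n).trans ?_⟩
  have hθn : 0 < θ ^ n := pow_pos hθ n
  have hθi : θ ^ (i + 1) ≤ 1 := pow_le_one₀ hθ.le hθ1.le
  calc ENNReal.ofReal (|Q i| * (θ * b) ^ i * (θ * b) / (θ ^ n * (θ * b) ^ n))
      = ENNReal.ofReal (θ ^ (i + 1) * (1 / θ ^ (2 * n) * (|Q i| * b ^ i * b / b ^ n))) := by
        congr 1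
        rw [pow_mul, pow_succ]
        field_simp
        ring
    _ ≤ ENNReal.ofReal (1 * (1 / θ ^ (2 * n) * (|Q i| * b ^ i * b / b ^ n))) := by
        gcongr
    _ = ENNReal.ofReal (1 / θ ^ (2 * n)) * ENNReal.ofReal (|Q i| * b ^ i * b / b ^ n) := by
        rw [one_mul, ENNReal.ofReal_mul (by positivity)]
    _ ≤ ENNReal.ofReal (1 / θ ^ (2 * n)) * (ENNReal.ofReal C *
          ∫⁻ w in Ioc (θ * b) b, ‖psum N Q w * (1 / w) ^ n‖ₑ) := by
        gcongr
        exact h Q b hb i hi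
    _ = ENNReal.ofReal (C / θ ^ (2 * n)) * ∫⁻ w in Ioc (θ * b) b, ‖psum N Q w * (1 / w) ^ n‖ₑ := by
        rw [← mul_assoc, ← ENNReal.ofReal_mul (by positivity)]
        congr 2
        field_simp

/-! ### The brick -/

/-- **The brick.** On a thick fibre `(lo, hi)`, `0 ≤ lo ≤ θ hi`, every weighted term
`|Q_i| w^i/w^n` is dominated in `L¹` by `|∑_j Q_j w^j| · w^{-n}`, with a constant depending only on
`N`, `n`, `θ`. -/
theorem brick (N n : ℕ) {θ : ℝ} (hθ : 0 < θ) (hθ1 : θ < 1) :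
    ∃ C : ℝ≥0∞, C ≠ ∞ ∧ ∀ (Q : ℕ → ℝ) (lo hi : ℝ), 0 ≤ lo → lo ≤ θ * hi → ∀ i < N,
      ∫⁻ w in Ioo lo hi, ‖Q i * (w ^ i / w ^ n)‖ₑ ≤
        C * ∫⁻ w in Ioo lo hi, ‖psum N Q w * (1 / w) ^ n‖ₑ := by
  obtain ⟨C₁, -, h₁⟩ := block_le N n hθ hθ1
  obtain ⟨C₂, -, h₂⟩ := partial_le N n hθ hθ1
  set c₁ := ENNReal.ofReal (C₁ / θ ^ n) with hc₁
  set c₂ := ENNReal.ofReal (C₂ / θ ^ (2 * n)) with hc₂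
  refine ⟨c₁ + c₂, by simp [hc₁, hc₂], fun Q lo hi hlo hloθ i hiN => ?_⟩
  rcases le_or_gt hi 0 with hhi | hhi
  · have : Ioo lo hi = ∅ := Ioo_eq_empty (by
      intro h
      have : θ * hi ≤ 0 := mul_nonpos_of_nonneg_of_nonpos hθ.le hhi
      linarith)
    rw [this]
    simp
  -- geometric blocks
  set u : ℕ → ℝ := fun k => θ ^ k * hi with hu
  have hu0 : ∀ k, 0 < u k := fun k => mul_pos (pow_pos hθ k) hhi
  have husucc : ∀ k, u (k + 1) = θ * u k := fun k => by simp only [hu, pow_succ]; ring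
  have hanti : Antitone u := by
    refine antitone_nat_of_succ_le fun k => ?_
    rw [husucc]
    exact mul_le_of_le_one_left (hu0 k).le hθ1.le
  set B : ℕ → Set ℝ := fun k => Ioc (u (k + 1)) (u k) with hB
  set f : ℝ → ℝ≥0∞ := fun w => ‖Q i * (w ^ i / w ^ n)‖ₑ with hf
  set g : ℝ → ℝ≥0∞ := fun w => ‖psum N Q w * (1 / w) ^ n‖ₑ with hg
  set R : ℕ → ℝ≥0∞ := fun k => ∫⁻ w in B k ∩ Ioi lo, g w with hR
  set R' : ℕ → ℝ≥0∞ := fun k => if k = 0 then 0 else R (k - 1) with hR'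
  -- the blocks cover the fibre
  have hcov : Ioo lo hi ⊆ ⋃ k, B k ∩ Ioi lo := by
    intro w hw
    have hw0 : 0 < w := hlo.trans_lt hw.1
    have hex : ∃ k, u (k + 1) < w := by
      obtain ⟨k, hk⟩ := exists_pow_lt_of_lt_one (div_pos hw0 hhi) hθ1
      refine ⟨k, ?_⟩
      calc u (k + 1) ≤ u k := hanti (Nat.le_succ k)
        _ = θ ^ k * hi := rfl
        _ < w / hi * hi := mul_lt_mul_of_pos_right hk hhi
        _ = w := div_mul_cancel₀ w hhi.ne'
    classical
    refine mem_iUnion.2 ⟨Nat.find hex, ⟨Nat.find_spec hex, ?_⟩, hw.1⟩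
    rcases Nat.eq_zero_or_pos (Nat.find hex) with h0 | hpos
    · rw [h0]
      show w ≤ θ ^ 0 * hi
      rw [pow_zero, one_mul]; exact hw.2.le
    · have := Nat.find_min hex (Nat.sub_one_lt_of_lt hpos)
      rw [Nat.sub_one_add_one_eq_of_pos hpos] at this
      exact not_lt.1 this
  -- blockwise estimate
  have hblock : ∀ k, ∫⁻ w in B k ∩ Ioi lo, f w ≤ c₁ * R k + c₂ * R' k := by
    intro k
    by_cases h1 : u k ≤ lo
    · have : B k ∩ Ioi lo = ∅ := by
        ext w
        simp only [hB, mem_inter_iff, mem_Ioc, mem_Ioi, mem_empty_iff_false, iff_false, not_and,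
          not_lt, and_imp]
        intro _ hwk
        exact hwk.trans h1
      rw [this]
      simp
    push Not at h1
    by_cases h2 : lo ≤ u (k + 1)
    · have hBk : B k ∩ Ioi lo = B k :=
        inter_eq_left.2 fun w hw => lt_of_le_of_lt h2 hw.1
      have hb := h₁ Q (u k) (hu0 k) i hiN
      rw [← husucc] at hb
      calc ∫⁻ w in B k ∩ Ioi lo, f w = ∫⁻ w in B k, f w := by rw [hBk]
        _ ≤ c₁ * ∫⁻ w in B k, g w := hb
        _ = c₁ * R k := by simp only [hR, hBk]
        _ ≤ c₁ * R k + c₂ * R' k := le_self_add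
    · push Not at h2
      have hk0 : k ≠ 0 := by
        rintro rfl
        have : u (0 + 1) = θ * hi := by simp [hu]
        rw [this] at h2
        exact absurd hloθ (not_le.2 h2)
      obtain ⟨k', rfl⟩ := Nat.exists_eq_add_one_of_ne_zero hk0
      have hprev : B k' ∩ Ioi lo = B k' :=
        inter_eq_left.2 fun w hw => lt_trans h1 hw.1
      have hb := h₂ Q (u k') (hu0 k') i hiN
      rw [← husucc, ← husucc] at hb
      calc ∫⁻ w in B (k' + 1) ∩ Ioi lo, f w ≤ ∫⁻ w in B (k' + 1), f w :=
            lintegral_mono_set inter_subset_left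
        _ ≤ c₂ * ∫⁻ w in B k', g w := hb
        _ = c₂ * R' (k' + 1) := by simp only [hR', hR, hprev, Nat.add_sub_cancel, if_neg (Nat.succ_ne_zero k')]
        _ ≤ c₁ * R (k' + 1) + c₂ * R' (k' + 1) := le_add_self
  -- summing the blocks
  have hdisj : Pairwise (Function.onFun Disjoint fun k => B k ∩ Ioi lo) := by
    have hd := hanti.pairwise_disjoint_on_Ioc_succ
    intro k l hkl
    have := hd hkl
    simp only [Function.onFun, Order.succ_eq_add_one] at this ⊢
    exact this.mono inter_subset_left inter_subset_left
  have hmeas : ∀ k, MeasurableSet (B k ∩ Ioi lo) := fun k => measurableSet_Ioc.inter measurableSet_Ioi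
  have hsub : (⋃ k, B k ∩ Ioi lo) ⊆ Ioc lo hi := by
    refine iUnion_subset fun k w hw => ⟨hw.2, hw.1.2.trans ?_⟩
    calc u k ≤ u 0 := hanti (Nat.zero_le k)
      _ = hi := by simp [hu]
  have hshift : ∑' k, R' k = ∑' k, R k := by
    rw [tsum_eq_zero_add' ENNReal.summable]
    simp [hR']
  calc ∫⁻ w in Ioo lo hi, f w ≤ ∫⁻ w in ⋃ k, B k ∩ Ioi lo, f w := lintegral_mono_set hcov
    _ ≤ ∑' k, ∫⁻ w in B k ∩ Ioi lo, f w := lintegral_iUnion_le _ _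
    _ ≤ ∑' k, (c₁ * R k + c₂ * R' k) := ENNReal.tsum_le_tsum hblock
    _ = c₁ * ∑' k, R k + c₂ * ∑' k, R' k := by
        rw [ENNReal.tsum_add, ENNReal.tsum_mul_left, ENNReal.tsum_mul_left]
    _ = (c₁ + c₂) * ∑' k, R k := by rw [hshift, add_mul]
    _ = (c₁ + c₂) * ∫⁻ w in ⋃ k, B k ∩ Ioi lo, g w := by rw [lintegral_iUnion hmeas hdisj]
    _ ≤ (c₁ + c₂) * ∫⁻ w in Ioc lo hi, g w := by
        gcongr (c₁ + c₂) * ?_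
        exact lintegral_mono_set hsub
    _ = (c₁ + c₂) * ∫⁻ w in Ioo lo hi, g w := by rw [Measure.restrict_congr_set Ioo_ae_eq_Ioc]

end SepThree

/-- **The one-dimensional brick** (registered part of `stub_separateThreeZero`; literal form of
`SepThree.brick`): on a thick fibre `(lo, hi)`, `0 ≤ lo ≤ θ hi` with `0 < θ < 1`, every weighted
term `|Q_i| w^i/w^n` of a polynomial `∑_{j<N} Q_j w^j` is dominated in `L¹` by
`|∑_j Q_j w^j| w^{-n}`, with a constant depending only on `N`, `n`, `θ`. -/
theorem separateThree_brick (N n : ℕ) (θ : ℝ) (hθ : 0 < θ) (hθ1 : θ < 1) : ∃ C : ENNReal, C ≠ ⊤ ∧ ∀ (Q : ℕ → ℝ) (lo hi : ℝ), 0 ≤ lo → lo ≤ θ * hi → ∀ i < N, MeasureTheory.lintegral (MeasureTheory.volume.restrict (Set.Ioo lo hi)) (fun w => ‖Q i * (w ^ i / w ^ n)‖ₑ) ≤ C * MeasureTheory.lintegral (MeasureTheory.volume.restrict (Set.Ioo lo hi)) (fun w => ‖(∑ j ∈ Finset.range N, Q j * w ^ j) * (1 / w) ^ n‖ₑ) :=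 by
  exact SepThree.brick N n hθ hθ1

end Summit.KontsevichZagierPeriods.ArrangementNormalForm.JanusBands
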